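import Mathlib
import HarnessLib
import Literature.Computability.AlgebraicComplexity.SymmetricArithCircuit
import Literature.Computability.AlgebraicComplexity.MonotoneStructure

/-!
# ValiantsHypothesis / MonotoneRestoration — `MonotoneRestorationQP`, line `Sketch`, stub G3

Support file for crux item `stmt-ValiantsHypothesis-15886`
(`Summit.ValiantsHypothesis.ValiantsHypothesis.Theses.MonotoneRestoration.MonotoneRestorationQP`),
line `Sketch`, stub `stub_mulGate_children_extend` (monotone structure at a multiplication gate).

Over the semiring `ℝ≥0` nothing cancels: the support of a product of polynomials is the
Minkowski sum of the supports (`add_mem_support_mul`). In a labelled arithmetic circuit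
(`LabelledArithCircuit`, Dawar–Wilsenach Def. 2.2) a `×` gate `P` evaluates to the product of
its children (`eval_of_label_mul`; `children P` is a `Finset`, each child occurs once). If
`eval P ≠ 0` and every monomial of `eval P` shifted by a common monomial `μ` is a monomial of
`f`, then

* every monomial of a child `h`, shifted by `μ + m₀` with `m₀` any monomial of the (nonzero)
  cofactor `∏_{h'' ≠ h} eval h''` (`Finset.mul_prod_erase`), is a monomial of `f`;
* for two different children `h ≠ h'` and monomials `m`, `m'` of `eval h`, `eval h'`, the sum
  `m + m'` shifted by `μ + m₀` (`m₀` a monomial of the cofactor of `h, h'`, erase twice) is a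
  monomial of `f`.
-/

-- `Summit.ValiantsHypothesis.ValiantsHypothesis.…` is the tree's mandated single-conjunct layout
-- (Sub = Summit), so the duplicated namespace component is intended.
set_option linter.dupNamespace false

noncomputable section

namespace Summit.ValiantsHypothesis.ValiantsHypothesis.Theorems

open Literature.Computability.AlgebraicComplexity MvPolynomial
open scoped NNReal

/-- **G3 — monotone structure at a multiplication gate (no cancellation over `ℝ≥0`).** If the
monomials of a nonzero `×` gate `P` extend (by a common monomial `μ`) to monomials of `f`, then
so do the monomials of each child (context: `μ` plus one monomial of the cofactor), and the
sum of a monomial of one child and a monomial of a different child extends to a monomial of `f`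
(`add_mem_support_mul`, `Finset.mul_prod_erase`). [folklore] -/
theorem stub_mulGate_children_extend {n : ℕ} {G : Type}
    (C : LabelledArithCircuit NNReal (Fin n × Fin n) Unit G) (f : MvPolynomial (Fin n × Fin n) NNReal)
    {P : G} (hP : C.label P = .mul) (hP0 : C.eval P ≠ 0)
    (hext : ∃ μ : (Fin n × Fin n) →₀ ℕ, ∀ m ∈ (C.eval P).support, m + μ ∈ f.support) :
    (∀ h ∈ C.children P, ∃ μ : (Fin n × Fin n) →₀ ℕ, ∀ m ∈ (C.eval h).support, m + μ ∈ f.support) ∧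
    (∀ h ∈ C.children P, ∀ h' ∈ C.children P, h ≠ h' →
      ∀ m ∈ (C.eval h).support, ∀ m' ∈ (C.eval h').support,
        ∃ μ : (Fin n × Fin n) →₀ ℕ, m + m' + μ ∈ f.support) := by
  classical
  obtain ⟨μ, hμ⟩ := hext
  refine ⟨fun h hh => ?_, fun h hh h' hh' hne m hm m' hm' => ?_⟩
  · -- `eval P = eval h * R` with a nonzero cofactor `R`
    have hPR : C.eval P = C.eval h * ∏ x ∈ (C.children P).erase h, C.eval x := by
      rw [C.eval_of_label_mul hP, Finset.mul_prod_erase (C.children P) (fun x => C.eval x) hh]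
    have hR0 : (∏ x ∈ (C.children P).erase h, C.eval x) ≠ 0 := by
      intro h0
      exact hP0 (by rw [hPR, h0, mul_zero])
    obtain ⟨m₀, hm₀⟩ := MvPolynomial.support_nonempty.2 hR0
    refine ⟨m₀ + μ, fun m hm => ?_⟩
    rw [← add_assoc]
    exact hμ _ (by rw [hPR]; exact add_mem_support_mul hm hm₀)
  · -- `eval P = eval h * (eval h' * R)` with a nonzero cofactor `R`
    have hh'e : h' ∈ (C.children P).erase h := Finset.mem_erase.2 ⟨hne.symm, hh'⟩
    have hPR : C.eval P =
        C.eval h * (C.eval h' * ∏ x ∈ ((C.children P).erase h).erase h', C.eval x) := by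
      rw [C.eval_of_label_mul hP,
        Finset.mul_prod_erase ((C.children P).erase h) (fun x => C.eval x) hh'e,
        Finset.mul_prod_erase (C.children P) (fun x => C.eval x) hh]
    have hR0 : (∏ x ∈ ((C.children P).erase h).erase h', C.eval x) ≠ 0 := by
      intro h0
      exact hP0 (by rw [hPR, h0, mul_zero, mul_zero])
    obtain ⟨m₀, hm₀⟩ := MvPolynomial.support_nonempty.2 hR0
    refine ⟨m₀ + μ, ?_⟩
    rw [← add_assoc, add_assoc m m' m₀]
    exact hμ _ (by rw [hPR]; exact add_mem_support_mul hm (add_mem_support_mul hm' hm₀))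

end Summit.ValiantsHypothesis.ValiantsHypothesis.Theorems

end
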